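import Summits.AtomisticToContinuum.HydrodynamicLimit.Theses.ImplosionDichotomy
import Summits.AtomisticToContinuum.HydrodynamicLimit.Theorems.HydroLimitInBand.Negative.VacuousRegime
import HarnessLib

/-!
# `HydroLimitProfilewiseBand` (crux stmt-AtomisticToContinuum-17372), negative side: the threshold `σ₀` is IDLE

Standing crux disprover `refuter-cdisprove-stmt-AtomisticToContinuum-17372-0`, cycle 1 (2026-08-17), `Disproof.lean` §2.

Hypothesis-mutation finding ("hᵢ possibly unnecessary", kernel-certified): in the crux
`∀ profiles ∃ η > 0 ∃ σ₀ > 0 ∀ σ ∈ (0, σ₀) ∀ classical solutions with packing ρ_t(x)σ³ < η, tie at t = 0 ⇒ LLN at t`,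
the inner threshold `∃ σ₀, … σ < σ₀ …` carries NO content: the crux is EQUIVALENT to its threshold-free form
`∀ profiles ∃ η > 0 ∀ σ > 0 …` (`hydroLimitProfilewiseBand_iff_noThreshold`). Diluteness is entirely encoded by the
packing guard. The mechanism is a two-case dichotomy valid at EVERY `σ > 0` — no statics threshold, no probability
normalisation of the local Gibbs laws, no flow property is used (contrast the sibling's `sigma_cube_lt_of_guard`,
which works below the statics threshold of data pinning only):

* `integral_eq_one_or_tendsto_measure_univ` — the `t = s` convergence tested against `χ ≡ 1` (the empirical density of
  `N + 1` particles is identically `1`, whatever the configuration) forces EITHER `∫ ρ_s = 1` OR the total masses of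
  the laws tend to `0`;
* `tendstoHydroFieldsAt_of_tendsto_measure_univ` — in the second case EVERY `TendstoHydroFieldsAt` statement holds
  (deviation probabilities are bounded by the total mass), so the conclusion of the crux is free;
* in the first case `ρ_0 ≥ 1` somewhere (`exists_integral_le`, continuity of the time-`0` slice of a classical solution),
  and the guard there reads `σ³ ≤ ρ_0(x)σ³ < η`: with `η' := min η σ₀³` the guard itself enforces `σ < σ₀`.

Consequences for provers / planners: (i) WLOG the crux may be read as "at EVERY reduced density `σ > 0`, every classical
solution whose packing stays below the (profile-dependent) cap is followed by the empirical fields" — the smallness of `σ`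
is not an extra hypothesis but a consequence of the cap and unit mass; (ii) no line should spend a stub on producing `σ₀`;
(iii) a refuter gains nothing from large `σ`. (iv) ASYMMETRY WITH THE UNIFORM SIBLING (§4): for `HydroLimitInBand`
(`∃ η₀ ∀ profiles ∃ σ₀(profiles) …` = the re-typed Statement) the same argument trades the profile-dependent `σ₀` for the
profile-dependent cap `min η₀ σ₀³`, so it lands in the PROFILE-WISE threshold-free form only
(`noThreshold_of_hydroLimitInBand`); the UNIFORM threshold-free form `HydroLimitUniformBandNoThreshold`
(`∃ η₀ ∀ profiles ∀ σ > 0 …`) implies the Statement (`hydroLimitInBand_of_uniformNoThreshold`) but is not formally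
recovered from it. The four statements therefore line up as
`HydroLimitUniformBandNoThreshold → HydroLimitInBand → HydroLimitProfilewiseBand ↔ HydroLimitProfilewiseBandNoThreshold`:
dropping the threshold and swapping `∃ η₀ ∀ profiles` to `∀ profiles ∃ η` are the two commuting relaxations of the
Statement, and the crux is where both have been applied.
-/

noncomputable section

open MeasureTheory Filter Set Topology
open scoped ENNReal

namespace Summit.AtomisticToContinuum.HydrodynamicLimit.Theorems

open Literature.MathematicalPhysics.KineticTheory Literature.Analysis.FluidPDE
open Summit.AtomisticToContinuum.HydrodynamicLimit.Theses.ImplosionDichotomy (HydroLimitProfilewiseBand)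
open PolynomialCompressionPDE (Flows continuous_slices_zero)
open HydroLimitInBandNegative (exists_integral_le)

namespace HydroLimitProfilewiseBandNegative

/-! ## §1 Two junk-robust facts about `TendstoHydroFieldsAt` (any laws, any flows, any fields) -/

/-- **Vanishing total mass makes every hydrodynamic convergence statement true**: if `P N univ → 0` then
`TendstoHydroFieldsAt P Φ ρ u θ t` for all fields and times (each deviation probability is at most the total
mass). [folklore] -/
theorem tendstoHydroFieldsAt_of_tendsto_measure_univ {ε : ℕ → ℝ}
    (P : (N : ℕ) → Measure (Config (N + 1) (Fin 3) T3))
    (Φ : (N : ℕ) → HardSphereFlow (Torus.geometry (Fin 3)) (ε N) (N + 1))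
    (ρ θ : ℝ → T3 → ℝ) (u : ℝ → T3 → V3) (t : ℝ)
    (h : Tendsto (fun N => P N univ) atTop (𝓝 0)) : TendstoHydroFieldsAt P Φ ρ u θ t := by
  intro χ _ δ _
  refine ⟨?_, ?_, ?_⟩ <;>
    exact tendsto_of_tendsto_of_tendsto_of_le_of_le tendsto_const_nhds h (fun N => bot_le)
      (fun N => measure_mono (subset_univ _))

/-- **Unit mass or vanishing laws.** If the empirical fields at time `s` follow `(ρ, u, θ)` in probability
(`TendstoHydroFieldsAt P Φ ρ u θ s`), then EITHER `∫ ρ_s = 1` OR the total masses `P N univ` tend to `0`: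
test against `χ ≡ 1`, for which the empirical density of `N + 1` particles is identically `1`
(`empiricalDensityField_one`) — so the deviation event is all of phase space as soon as `∫ ρ_s ≠ 1`.
No property of the laws or of the flows is used. [folklore] -/
theorem integral_eq_one_or_tendsto_measure_univ {ε : ℕ → ℝ}
    {P : (N : ℕ) → Measure (Config (N + 1) (Fin 3) T3)}
    {Φ : (N : ℕ) → HardSphereFlow (Torus.geometry (Fin 3)) (ε N) (N + 1)}
    {ρ θ : ℝ → T3 → ℝ} {u : ℝ → T3 → V3} {s : ℝ} (h : TendstoHydroFieldsAt P Φ ρ u θ s) :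
    (∫ x, ρ s x = 1) ∨ Tendsto (fun N => P N univ) atTop (𝓝 0) := by
  by_cases hm : ∫ x, ρ s x = 1
  · exact Or.inl hm
  refine Or.inr ?_
  have hne : (1 : ℝ) - ∫ x, ρ s x ≠ 0 := sub_ne_zero.2 (Ne.symm hm)
  have hδ : 0 < |1 - ∫ x, ρ s x| / 2 := by positivity
  obtain ⟨hd, -, -⟩ := h (fun _ => 1) continuous_const _ hδ
  refine hd.congr' (Eventually.of_forall fun N => ?_)
  congr 1
  refine (eq_univ_of_forall fun z => ?_)
  simp only [mem_setOf_eq, one_mul, empiricalDensityField_one (Nat.succ_ne_zero N)]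
  have hpos : 0 < |1 - ∫ x, ρ s x| := abs_pos.2 hne
  linarith

/-! ## §2 The threshold-free form of the crux and the equivalence -/

/-- **The crux with the threshold `σ₀` removed**: for all continuous positive profiles there is a cap `η > 0` such
that at EVERY reduced density `σ > 0`, every classical hard-sphere Euler solution with packing `< η`, tied at `t = 0`,
is followed at every `t < T` (everything else verbatim `ImplosionDichotomy.HydroLimitProfilewiseBand`). -/
def HydroLimitProfilewiseBandNoThreshold : Prop :=
  ∀ (a₀ θ₀ : T3 → ℝ) (u₀ : T3 → V3), Continuous a₀ → Continuous θ₀ → Continuous u₀ →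
    (∀ x, 0 < a₀ x) → (∀ x, 0 < θ₀ x) → ∃ η : ℝ, 0 < η ∧ ∀ σ : ℝ, 0 < σ →
    ∀ (T : ℝ) (ρ θ : ℝ → T3 → ℝ) (u : ℝ → T3 → V3), IsHardSphereEulerSolution σ T ρ u θ →
    (∀ t ∈ Ico 0 T, ∀ x, ρ t x * σ ^ 3 < η) →
    ∀ Φ : Flows σ, TendstoHydroFieldsAt (fun N => localGibbsLaw σ a₀ u₀ θ₀ N (Φ N)) Φ ρ u θ 0 →
    ∀ t ∈ Ico 0 T, TendstoHydroFieldsAt (fun N => localGibbsLaw σ a₀ u₀ θ₀ N (Φ N)) Φ ρ u θ t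

/-- The threshold-free form trivially implies the crux (`σ₀ := 1`). [folklore] -/
theorem hydroLimitProfilewiseBand_of_noThreshold (h : HydroLimitProfilewiseBandNoThreshold) :
    HydroLimitProfilewiseBand := by
  intro a₀ θ₀ u₀ ha hθ hu ha0 hθ0
  obtain ⟨η, hη, G⟩ := h a₀ θ₀ u₀ ha hθ hu ha0 hθ0
  exact ⟨η, hη, 1, one_pos, fun σ hσ _ => G σ hσ⟩

/-- **The threshold `σ₀` is idle**: the crux implies its threshold-free form with the cap `η' := min η σ₀³`.
At any `σ > 0`: if the laws' total mass tends to `0` the conclusion is free; otherwise the tie at `t = 0` gives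
`∫ ρ_0 = 1`, hence `ρ_0(x₀) ≥ 1` at a maximum point of the continuous slice, and the guard at `(0, x₀)` yields
`σ³ ≤ ρ_0(x₀) σ³ < σ₀³`, i.e. `σ < σ₀`, where the crux applies. [folklore] -/
theorem noThreshold_of_hydroLimitProfilewiseBand (h : HydroLimitProfilewiseBand) :
    HydroLimitProfilewiseBandNoThreshold := by
  intro a₀ θ₀ u₀ ha hθ hu ha0 hθ0
  obtain ⟨η, hη, σ₀, hσ₀, G⟩ := h a₀ θ₀ u₀ ha hθ hu ha0 hθ0
  refine ⟨min η (σ₀ ^ 3), lt_min hη (pow_pos hσ₀ 3), fun σ hσ T ρ θ u hE hguard Φ h0 t ht => ?_⟩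
  have hT : 0 < T := ht.1.trans_lt ht.2
  rcases integral_eq_one_or_tendsto_measure_univ h0 with hm | hmass
  · obtain ⟨hρc, -, -⟩ := continuous_slices_zero hE hT
    obtain ⟨x₀, hx₀⟩ := exists_integral_le hρc
    rw [hm] at hx₀
    have hσ3 : 0 < σ ^ 3 := pow_pos hσ 3
    have h1 : σ ^ 3 ≤ ρ 0 x₀ * σ ^ 3 := le_mul_of_one_le_left hσ3.le hx₀
    have h2 : ρ 0 x₀ * σ ^ 3 < σ₀ ^ 3 := (hguard 0 ⟨le_rfl, hT⟩ x₀).trans_le (min_le_right _ _)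
    have hσlt : σ < σ₀ := lt_of_pow_lt_pow_left₀ 3 hσ₀.le (h1.trans_lt h2)
    exact G σ hσ hσlt T ρ θ u hE (fun s hs x => (hguard s hs x).trans_le (min_le_left _ _)) Φ h0 t ht
  · exact tendstoHydroFieldsAt_of_tendsto_measure_univ _ _ ρ θ u t hmass

/-- **`HydroLimitProfilewiseBand ↔ HydroLimitProfilewiseBandNoThreshold`.** The `∃ σ₀` of the crux is redundant:
diluteness is the packing cap. [folklore] -/
theorem hydroLimitProfilewiseBand_iff_noThreshold :
    HydroLimitProfilewiseBand ↔ HydroLimitProfilewiseBandNoThreshold :=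
  ⟨noThreshold_of_hydroLimitProfilewiseBand, hydroLimitProfilewiseBand_of_noThreshold⟩

/-! ## §3 Corollary: at each profile the crux is decided by arbitrarily small caps at all densities -/

/-- The threshold-free inner body is antitone in the cap: a smaller cap admits fewer solutions. [folklore] -/
theorem noThreshold_body_anti {η η' : ℝ} (hle : η ≤ η') {a₀ θ₀ : T3 → ℝ} {u₀ : T3 → V3}
    (G : ∀ σ : ℝ, 0 < σ → ∀ (T : ℝ) (ρ θ : ℝ → T3 → ℝ) (u : ℝ → T3 → V3), IsHardSphereEulerSolution σ T ρ u θ →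
      (∀ t ∈ Ico 0 T, ∀ x, ρ t x * σ ^ 3 < η') →
      ∀ Φ : Flows σ, TendstoHydroFieldsAt (fun N => localGibbsLaw σ a₀ u₀ θ₀ N (Φ N)) Φ ρ u θ 0 →
      ∀ t ∈ Ico 0 T, TendstoHydroFieldsAt (fun N => localGibbsLaw σ a₀ u₀ θ₀ N (Φ N)) Φ ρ u θ t) :
    ∀ σ : ℝ, 0 < σ → ∀ (T : ℝ) (ρ θ : ℝ → T3 → ℝ) (u : ℝ → T3 → V3), IsHardSphereEulerSolution σ T ρ u θ →
      (∀ t ∈ Ico 0 T, ∀ x, ρ t x * σ ^ 3 < η) →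
      ∀ Φ : Flows σ, TendstoHydroFieldsAt (fun N => localGibbsLaw σ a₀ u₀ θ₀ N (Φ N)) Φ ρ u θ 0 →
      ∀ t ∈ Ico 0 T, TendstoHydroFieldsAt (fun N => localGibbsLaw σ a₀ u₀ θ₀ N (Φ N)) Φ ρ u θ t :=
  fun σ hσ T ρ θ u hE hguard => G σ hσ T ρ θ u hE fun s hs x => (hguard s hs x).trans_le hle

/-! ## §4 The uniform sibling: the threshold folds into a PROFILE-DEPENDENT cap only -/

/-- **The UNIFORM threshold-free band**: ONE cap `η₀ > 0` such that at EVERY reduced density `σ > 0`, for all profiles,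
every classical solution with packing `< η₀`, tied at `t = 0`, is followed (the sibling `HydroLimitInBand` = the re-typed
Statement with its profile-dependent threshold `σ₀` removed). -/
def HydroLimitUniformBandNoThreshold : Prop :=
  ∃ η₀ : ℝ, 0 < η₀ ∧ ∀ (a₀ θ₀ : T3 → ℝ) (u₀ : T3 → V3), Continuous a₀ → Continuous θ₀ → Continuous u₀ →
    (∀ x, 0 < a₀ x) → (∀ x, 0 < θ₀ x) → ∀ σ : ℝ, 0 < σ →
    ∀ (T : ℝ) (ρ θ : ℝ → T3 → ℝ) (u : ℝ → T3 → V3), IsHardSphereEulerSolution σ T ρ u θ →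
    (∀ t ∈ Ico 0 T, ∀ x, ρ t x * σ ^ 3 < η₀) →
    ∀ Φ : Flows σ, TendstoHydroFieldsAt (fun N => localGibbsLaw σ a₀ u₀ θ₀ N (Φ N)) Φ ρ u θ 0 →
    ∀ t ∈ Ico 0 T, TendstoHydroFieldsAt (fun N => localGibbsLaw σ a₀ u₀ θ₀ N (Φ N)) Φ ρ u θ t

/-- The uniform threshold-free band implies the sibling `HydroLimitInBand` (= the Statement): `σ₀ := 1`. It is the
formally STRONGEST of the four shapes; the converse is not formal (the Statement's `σ₀` may depend on the profile while
its cap may not). [folklore] -/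
theorem hydroLimitInBand_of_uniformNoThreshold (h : HydroLimitUniformBandNoThreshold) :
    Summit.AtomisticToContinuum.HydrodynamicLimit.Theses.ImplosionDichotomy.HydroLimitInBand := by
  obtain ⟨η₀, hη₀, G⟩ := h
  exact ⟨η₀, hη₀, fun a₀ θ₀ u₀ ha hθ hu ha0 hθ0 =>
    ⟨1, one_pos, fun σ hσ _ => G a₀ θ₀ u₀ ha hθ hu ha0 hθ0 σ hσ⟩⟩

/-- The uniform threshold-free band implies the profile-wise one (`η := η₀`). [folklore] -/
theorem noThreshold_of_uniformNoThreshold (h : HydroLimitUniformBandNoThreshold) :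
    HydroLimitProfilewiseBandNoThreshold := by
  obtain ⟨η₀, hη₀, G⟩ := h
  exact fun a₀ θ₀ u₀ ha hθ hu ha0 hθ0 => ⟨η₀, hη₀, G a₀ θ₀ u₀ ha hθ hu ha0 hθ0⟩

/-- From the sibling `HydroLimitInBand` the threshold argument yields the PROFILE-WISE threshold-free form (cap
`min η₀ σ₀(profiles)³`), not the uniform one: the `σ₀`-removal and the `∀∃` swap are the two commuting relaxations of
the Statement and the crux `HydroLimitProfilewiseBand` is their meet. [folklore] -/
theorem noThreshold_of_hydroLimitInBand
    (h : Summit.AtomisticToContinuum.HydrodynamicLimit.Theses.ImplosionDichotomy.HydroLimitInBand) :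
    HydroLimitProfilewiseBandNoThreshold := by
  refine noThreshold_of_hydroLimitProfilewiseBand fun a₀ θ₀ u₀ ha hθ hu ha0 hθ0 => ?_
  obtain ⟨η₀, hη₀, H⟩ := h
  obtain ⟨σ₀, hσ₀, G⟩ := H a₀ θ₀ u₀ ha hθ hu ha0 hθ0
  exact ⟨η₀, hη₀, σ₀, hσ₀, G⟩

end HydroLimitProfilewiseBandNegative

end Summit.AtomisticToContinuum.HydrodynamicLimit.Theorems

end
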